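import Literature.Analysis.FluidPDE.KNSSMildDecayProofs
import Literature.Analysis.FluidPDE.OseenMildUniqueness
import Literature.Analysis.FluidPDE.SelfSimilar
import HarnessLib

/-!
# Route TypeICertificateLadder — crux `Target` (item stmt-NavierStokesRegularity-1217),
# line `killing-twisted-bernoulli-solitons`: forward uniqueness in the Type-I ancient class

Helper file (theorems only) for the mirror-symmetric stratum of the rotating-self-similar
Liouville programme (stub `rssStratum_typeI_forward_unique`). A mirror-symmetric RSS profile
yields two classical Type-I solutions on `t < 0` (the Pineau–Vicol ansatz at speeds `α` and
`−α`) with the same slice at `t = −1`; this file proves that two classical solutions of the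
unforced Navier–Stokes system (`ν = 1`) on `ℝ³ × (−∞, 0)` with the Type-I bound
`‖u(t, x)‖ ≤ C₀ / (‖x‖ + √(−t))` and the same slice at `t = −1` coincide on the window
`(−1, −1/2)`.

Proof. (1) *Mildness* (KNSS 2009, Thm 6.1, mildness clause; tree:
`KNSS2009_mild_of_rMulNorm_bounded_holds`): the Type-I bound gives, on `(−2, −1/2]`,
`‖u‖ ≤ 2 C₀` and `|x'| ‖u(t, x)‖ ≤ ‖x‖ ‖u(t, x)‖ ≤ C₀`, so for `−1 < t ≤ −1/2`
`u(t) = e^{(t+1)Δ} u(−1) − B¹_{−1}(u, u)(t)` pointwise, and the same for `v`; the free terms agree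
since `u(−1) = v(−1)`. (2) *Uniqueness of bounded solutions of the Oseen integral equation*
(KNSS 2009, §4 (4.3)–(4.4); Giga–Inui–Matsui 1999; tree: `oseenMild_bounded_unique`):
`u(t) = v(t)` a.e. for `t ∈ (−1, −1/2)` (joint measurability from joint continuity).
(3) Both slices are continuous, so `u(t) = v(t)` everywhere (`Continuous.ae_eq_iff_eq`).
-/

noncomputable section

-- the summit and its single sub-problem share the name (CONVENTIONS §1), as in every Theorems file
set_option linter.dupNamespace false

namespace Summit.NavierStokesRegularity.NavierStokesRegularity.Theorems

open Set Function Filter MeasureTheory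
open Literature.Analysis Literature.Analysis.FluidPDE

/-- The constant of a Type-I bound is nonnegative (evaluate at `t = −1`, `x = 0`). [folklore] -/
private theorem rssStratum_typeI_const_nonneg {C₀ : ℝ}
    {u : ℝ → EuclideanSpace ℝ (Fin 3) → EuclideanSpace ℝ (Fin 3)} (hI : HasTypeIDecay C₀ u) :
    0 ≤ C₀ := by
  have h := hI (-1) (by norm_num) 0
  rw [norm_zero, zero_add, neg_neg, Real.sqrt_one, div_one] at h
  exact (norm_nonneg _).trans h

/-- A Type-I field is bounded by `2 C₀` on `t ≤ −1/2` (indeed on `t ≤ −1/4`):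
`‖u(t, x)‖ ≤ C₀ / √(−t) ≤ 2 C₀`. [folklore] -/
private theorem rssStratum_typeI_norm_le {C₀ : ℝ}
    {u : ℝ → EuclideanSpace ℝ (Fin 3) → EuclideanSpace ℝ (Fin 3)} (hI : HasTypeIDecay C₀ u)
    {t : ℝ} (ht : t ≤ -(1 / 2)) (x : EuclideanSpace ℝ (Fin 3)) : ‖u t x‖ ≤ 2 * C₀ := by
  have hC := rssStratum_typeI_const_nonneg hI
  have h := hI t (by linarith) x
  have hs : (1 / 2 : ℝ) ≤ Real.sqrt (-t) := by
    have h4 : Real.sqrt ((1 / 2 : ℝ) ^ 2) = 1 / 2 := Real.sqrt_sq (by norm_num)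
    rw [← h4]
    exact Real.sqrt_le_sqrt (by nlinarith)
  have hden : (1 / 2 : ℝ) ≤ ‖x‖ + Real.sqrt (-t) := le_add_of_nonneg_of_le (norm_nonneg _) hs
  calc ‖u t x‖ ≤ C₀ / (‖x‖ + Real.sqrt (-t)) := h
    _ ≤ C₀ / (1 / 2) := div_le_div_of_nonneg_left hC (by norm_num) hden
    _ = 2 * C₀ := by ring

/-- The horizontal decay (6.2) of KNSS 2009 for a Type-I field:
`|x'| ‖u(t, x)‖ ≤ ‖x‖ ‖u(t, x)‖ ≤ C₀` for `t < 0`. [folklore] -/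
private theorem rssStratum_typeI_cylRadius_mul_norm_le {C₀ : ℝ}
    {u : ℝ → EuclideanSpace ℝ (Fin 3) → EuclideanSpace ℝ (Fin 3)} (hI : HasTypeIDecay C₀ u)
    {t : ℝ} (ht : t < 0) (x : EuclideanSpace ℝ (Fin 3)) : cylRadius x * ‖u t x‖ ≤ C₀ := by
  have hC := rssStratum_typeI_const_nonneg hI
  have hs : 0 < Real.sqrt (-t) := Real.sqrt_pos.2 (by linarith)
  have hden : 0 < ‖x‖ + Real.sqrt (-t) := by positivity
  calc cylRadius x * ‖u t x‖ ≤ ‖x‖ * (C₀ / (‖x‖ + Real.sqrt (-t))) :=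
        mul_le_mul (SereginSverak2009.cylRadius_le_norm' x) (hI t ht x) (norm_nonneg _)
          (norm_nonneg _)
    _ = C₀ * (‖x‖ / (‖x‖ + Real.sqrt (-t))) := by ring
    _ ≤ C₀ * 1 := by
        refine mul_le_mul_of_nonneg_left ?_ hC
        rw [div_le_one hden]
        linarith [hs.le]
    _ = C₀ := mul_one _

/-- **Mildness of Type-I classical solutions from `t = −1`** (KNSS 2009, Thm 6.1, mildness
clause, through `KNSS2009_mild_of_rMulNorm_bounded_holds` on the window `(−2, 0)` with
`T = −1/2`): for `−1 < t ≤ −1/2`, `u(t, x) = (e^{(t+1)Δ} u(−1))(x) − B¹_{−1}(u, u)(t)(x)`. [cite: KochNadirashviliSereginSverak2009, Thm 6.1 (mildness clause), proof last paragraph (arXiv:0709.3599 p. 12)] -/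
private theorem rssStratum_typeI_mild {C₀ : ℝ}
    {u : ℝ → EuclideanSpace ℝ (Fin 3) → EuclideanSpace ℝ (Fin 3)}
    {p : ℝ → EuclideanSpace ℝ (Fin 3) → ℝ} (hu : IsClassicalNSSolutionOn (Iio 0) 1 0 u p)
    (hI : HasTypeIDecay C₀ u) {t : ℝ} (h1t : -1 < t) (ht : t ≤ -(1 / 2))
    (x : EuclideanSpace ℝ (Fin 3)) :
    u t x = UnboundedOperators.heatExtension (u (-1)) (t - -1) x - oseenDuhamel 1 (-1) u u t x := by
  have hcl : IsClassicalNSSolutionOn (Ioo (-2) 0) 1 0 u p :=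
    hu.mono Ioo_subset_Iio_self (uniqueDiffOn_Ioo _ _)
  have hL : ∃ L : ℝ, ∀ τ ∈ Ioc (-2 : ℝ) (-(1 / 2)), ∀ y, ‖u τ y‖ ≤ L :=
    ⟨2 * C₀, fun τ hτ y => rssStratum_typeI_norm_le hI hτ.2 y⟩
  have hD : ∃ D : ℝ, ∀ τ ∈ Ioc (-2 : ℝ) (-(1 / 2)), ∀ y, cylRadius y * ‖u τ y‖ ≤ D :=
    ⟨C₀, fun τ hτ y => rssStratum_typeI_cylRadius_mul_norm_le hI (by linarith [hτ.2]) y⟩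
  exact KNSS2009_mild_of_rMulNorm_bounded_holds hcl (by norm_num) (by norm_num) hL hD
    (s := -1) (t := t) (by norm_num) h1t ht x

/-- **Forward uniqueness in the Type-I ancient class.** Two classical solutions `(u, p)`,
`(v, q)` of the unforced Navier–Stokes system (`ν = 1`) on `ℝ³ × (−∞, 0)` with the Type-I
bound `‖·(t, x)‖ ≤ C₀ / (‖x‖ + √(−t))` and the same slice at `t = −1` coincide at every
`t ∈ (−1, −1/2)`. Proof: both are mild from `t = −1` with the same free term `e^{(t+1)Δ} u(−1)`
(KNSS 2009, Thm 6.1, `rssStratum_typeI_mild`), bounded by `2 C₀` and jointly continuous on the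
window, so they agree a.e. at every time by uniqueness of bounded solutions of the Oseen
integral equation (`oseenMild_bounded_unique`, KNSS 2009 §4 (4.3)–(4.4)), hence everywhere by
continuity of the slices. [cite: KochNadirashviliSereginSverak2009, Thm 6.1 and §4 (4.3)–(4.4) (arXiv:0709.3599 pp. 8, 11–12)] -/
theorem rssStratum_typeI_forward_unique :
    ∀ (C₀ : ℝ) (u v : ℝ → EuclideanSpace ℝ (Fin 3) → EuclideanSpace ℝ (Fin 3))
      (p q : ℝ → EuclideanSpace ℝ (Fin 3) → ℝ),
      Literature.Analysis.FluidPDE.IsClassicalNSSolutionOn (Set.Iio 0) 1 0 u p →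
      Literature.Analysis.FluidPDE.IsClassicalNSSolutionOn (Set.Iio 0) 1 0 v q →
      Literature.Analysis.FluidPDE.HasTypeIDecay C₀ u →
      Literature.Analysis.FluidPDE.HasTypeIDecay C₀ v →
      u (-1) = v (-1) → ∀ t ∈ Set.Ioo (-1 : ℝ) (-(1 / 2)), u t = v t := by
  intro C₀ u v p q hu hv hIu hIv h0 t ht
  have hC : 0 ≤ C₀ := rssStratum_typeI_const_nonneg hIu
  have hsub : Ioo (-1 : ℝ) (-(1 / 2)) ⊆ Iio 0 := fun τ hτ => hτ.2.trans (by norm_num)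
  -- joint measurability on the window, from joint continuity
  have hmeas : ∀ {w : ℝ → EuclideanSpace ℝ (Fin 3) → EuclideanSpace ℝ (Fin 3)}
      {r : ℝ → EuclideanSpace ℝ (Fin 3) → ℝ}, IsClassicalNSSolutionOn (Iio 0) 1 0 w r →
      AEStronglyMeasurable (uncurry w)
        ((volume : Measure (ℝ × EuclideanSpace ℝ (Fin 3))).restrict
          (Ioo (-1 : ℝ) (-(1 / 2)) ×ˢ univ)) := by
    intro w r hw
    have hc : ContinuousOn (uncurry w) (Ioo (-1 : ℝ) (-(1 / 2)) ×ˢ univ) :=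
      hw.smooth_velocity.continuousOn.mono (prod_mono hsub Subset.rfl)
    exact hc.aestronglyMeasurable (measurableSet_Ioo.prod MeasurableSet.univ)
  -- uniqueness of bounded solutions of the Oseen integral equation from `s = -1`
  have key := oseenMild_bounded_unique (ν := 1) (M := 2 * C₀) (s := -1) (T := -(1 / 2))
    (u := u) (v := v)
    (U := fun τ y => UnboundedOperators.heatExtension (u (-1)) (τ - -1) y)
    one_pos (by positivity) (hmeas hu) (hmeas hv)
    (fun τ hτ y => rssStratum_typeI_norm_le hIu hτ.2.le y)
    (fun τ hτ y => rssStratum_typeI_norm_le hIv hτ.2.le y)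
    (fun τ hτ => Eventually.of_forall fun y => rssStratum_typeI_mild hu hIu hτ.1 hτ.2.le y)
    (fun τ hτ => Eventually.of_forall fun y => by
      have h := rssStratum_typeI_mild hv hIv hτ.1 hτ.2.le y
      rw [← h0] at h
      exact h)
  -- from a.e. to everywhere: both slices are continuous
  have hcu : Continuous (u t) := (hu.contDiff_velocity (hsub ht)).continuous
  have hcv : Continuous (v t) := (hv.contDiff_velocity (hsub ht)).continuous
  exact (hcu.ae_eq_iff_eq volume hcv).1 (key t ht)

end Summit.NavierStokesRegularity.NavierStokesRegularity.Theorems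

end
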